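import Literature.NumberTheory.CubicFields.ReducibleCubicRings
import Literature.NumberTheory.CubicFields.StabilizerFinite
import Literature.NumberTheory.CubicFields.IrreducibleNondegenerate
import Mathlib.Algebra.Polynomial.Roots
import HarnessLib

/-!
# The stabilizer of every nondegenerate binary cubic form is finite

Topic `Literature/NumberTheory/CubicFields`; the reducible complement of `StabilizerFinite.lean`
(irreducible `f`: `|Stab(f)| ≤ 3`), using `ReducibleCubicRings.lean` (a reducible form is
`GL₂(ℤ)`-equivalent to one with `a = 0`, `Disc(0, b, c, d) = b²(c² − 4bd)`).

Bhargava–Taniguchi–Thorne 2023, §2.4 (11): the weights `|Stab(x)|⁻¹` of Shintani's zeta functions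
are taken over all `x ∈ GL₂(ℤ)\V(ℤ)` with `Disc(x) ≠ 0`; they are finite because a nondegenerate
cubic étale algebra has finitely many automorphisms. This file proves the finiteness on the side
of forms, for every `f` with `Disc f ≠ 0`:

* `eq_of_mem_stabilizer_of_row_eq` — for `f = (0, b, c, d)` with `b ≠ 0`, an element of `Stab(f)`
  is determined by its first row and its determinant (two such elements differ by a shear
  `(1 0; k 1) ∈ Stab(f)`, and `(0, b, c, d) ∘ shear = (0, b, c + 2bk, …)` forces `k = 0`);
* `firstRows_finite` — the possible first rows `(p, q)` (primitive, with `q (bp² + cpq + dq²) = 0`)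
  form a finite set (`(±1, 0)` and the primitive vectors on the `≤ 2` rational root lines of the
  quadratic factor);
* `finite_stabilizer_of_a_eq_zero`, `finite_stabilizer_of_not_isIrreducible` — hence `Stab(f)` is
  finite for reducible nondegenerate `f` (stabilizers along an orbit are conjugate);
* **`finite_stabilizer_of_disc_ne_zero`**, `one_le_card_stabilizer_of_disc_ne_zero` — **`Stab(f)`
  is finite, `1 ≤ |Stab(f)|`, for every `f` with `Disc f ≠ 0`** (with `StabilizerFinite` for the
  irreducible ones), so every Shintani weight `1/|Stab(x)|` is a genuine positive rational.

## References

* M. Bhargava, T. Taniguchi, F. Thorne, *Improved error estimates for the Davenport–Heilbronn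
  theorems*, Math. Ann. 389 (2024) = arXiv:2107.12819, §2.4 (11) [BhargavaTaniguchiThorne2023].
-/

namespace Literature.NumberTheory.CubicFields

open BinaryCubic RingOfForm Polynomial

/-! ### Elements of the stabilizer of `(0, b, c, d)` are determined by first row and determinant -/

/-- The first-row and determinant constraints on an element of `Stab(0, b, c, d)`:
`q (bp² + cpq + dq²) = 0` (the `u³`-coefficient) and `ps − qr = ±1`. [folklore] -/
theorem row_constraint_of_mem_stabilizer {b c d : ℤ} {γ : GL (Fin 2) ℤ}
    (hγ : γ ∈ MulAction.stabilizer (GL (Fin 2) ℤ) (⟨0, b, c, d⟩ : BinaryCubic ℤ)) :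
    (γ : Matrix (Fin 2) (Fin 2) ℤ) 0 1 *
        (b * (γ : Matrix (Fin 2) (Fin 2) ℤ) 0 0 ^ 2 + c * (γ : Matrix (Fin 2) (Fin 2) ℤ) 0 0 * (γ : Matrix (Fin 2) (Fin 2) ℤ) 0 1
          + d * (γ : Matrix (Fin 2) (Fin 2) ℤ) 0 1 ^ 2) = 0 ∧
      IsCoprime ((γ : Matrix (Fin 2) (Fin 2) ℤ) 0 0) ((γ : Matrix (Fin 2) (Fin 2) ℤ) 0 1) := by
  set M : Matrix (Fin 2) (Fin 2) ℤ := (γ : Matrix (Fin 2) (Fin 2) ℤ) with hM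
  have hdet : IsUnit M.det := Matrix.isUnits_det_units γ
  rw [Matrix.det_fin_two] at hdet
  refine ⟨?_, ?_⟩
  · rw [mem_stabilizer_iff_twist] at hγ
    have ha := congrArg BinaryCubic.a hγ
    simp only [twist, subst, smul_a, Matrix.det_fin_two] at ha
    have h : (M 0 0 * M 1 1 - M 0 1 * M 1 0) * (M 0 1 * (b * M 0 0 ^ 2 + c * M 0 0 * M 0 1 + d * M 0 1 ^ 2)) = 0 := by
      linear_combination ha
    exact (mul_eq_zero.mp h).resolve_left hdet.ne_zero
  · -- `p s - q r = ±1` is a Bézout relation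
    rcases Int.isUnit_iff.mp hdet with h | h
    · exact ⟨M 1 1, -M 1 0, by linear_combination h⟩
    · exact ⟨-M 1 1, M 1 0, by linear_combination -h⟩

/-- A shear `(1 0; k 1)` in the stabilizer of `(0, b, c, d)`, `b ≠ 0`, is trivial:
`(0, b, c, d) ∘ (1 0; k 1) = (0, b, c + 2bk, …)`. [folklore] -/
theorem shear_eq_zero_of_mem_stabilizer {b c d : ℤ} (hb : b ≠ 0) {U : GL (Fin 2) ℤ}
    (hU : U ∈ MulAction.stabilizer (GL (Fin 2) ℤ) (⟨0, b, c, d⟩ : BinaryCubic ℤ))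
    (h00 : (U : Matrix (Fin 2) (Fin 2) ℤ) 0 0 = 1) (h01 : (U : Matrix (Fin 2) (Fin 2) ℤ) 0 1 = 0)
    (h11 : (U : Matrix (Fin 2) (Fin 2) ℤ) 1 1 = 1) : (U : Matrix (Fin 2) (Fin 2) ℤ) 1 0 = 0 := by
  rw [mem_stabilizer_iff_twist] at hU
  have hc := congrArg BinaryCubic.c hU
  simp only [twist, subst, smul_c, Matrix.det_fin_two, h00, h01, h11] at hc
  have : 2 * b * (U : Matrix (Fin 2) (Fin 2) ℤ) 1 0 = 0 := by linear_combination hc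
  rcases mul_eq_zero.mp this with h | h
  · exact absurd h (by positivity)
  · exact h

/-- **An element of `Stab(0, b, c, d)` (`b ≠ 0`) is determined by its first row and determinant.**
Two such elements `γ, γ'` differ by `U = γ' γ⁻¹ ∈ Stab` with first row `(1, 0)` and `det U = 1`, a
shear, hence trivial. [folklore] -/
theorem eq_of_mem_stabilizer_of_row_eq {b c d : ℤ} (hb : b ≠ 0) {γ γ' : GL (Fin 2) ℤ}
    (hγ : γ ∈ MulAction.stabilizer (GL (Fin 2) ℤ) (⟨0, b, c, d⟩ : BinaryCubic ℤ))
    (hγ' : γ' ∈ MulAction.stabilizer (GL (Fin 2) ℤ) (⟨0, b, c, d⟩ : BinaryCubic ℤ))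
    (h00 : (γ : Matrix (Fin 2) (Fin 2) ℤ) 0 0 = (γ' : Matrix (Fin 2) (Fin 2) ℤ) 0 0)
    (h01 : (γ : Matrix (Fin 2) (Fin 2) ℤ) 0 1 = (γ' : Matrix (Fin 2) (Fin 2) ℤ) 0 1)
    (hdet : (γ : Matrix (Fin 2) (Fin 2) ℤ).det = (γ' : Matrix (Fin 2) (Fin 2) ℤ).det) : γ = γ' := by
  set U : GL (Fin 2) ℤ := γ' * γ⁻¹ with hUdef
  have hUmem : U ∈ MulAction.stabilizer (GL (Fin 2) ℤ) (⟨0, b, c, d⟩ : BinaryCubic ℤ) :=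
    (MulAction.stabilizer (GL (Fin 2) ℤ) _).mul_mem hγ' ((MulAction.stabilizer (GL (Fin 2) ℤ) _).inv_mem hγ)
  -- `U γ = γ'` as matrices
  have hUγ : (U : Matrix (Fin 2) (Fin 2) ℤ) * (γ : Matrix (Fin 2) (Fin 2) ℤ) = (γ' : Matrix (Fin 2) (Fin 2) ℤ) := by
    rw [hUdef, ← Units.val_mul, inv_mul_cancel_right]
  set M := (γ : Matrix (Fin 2) (Fin 2) ℤ) with hM
  set M' := (γ' : Matrix (Fin 2) (Fin 2) ℤ) with hM'
  set V := (U : Matrix (Fin 2) (Fin 2) ℤ) with hV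
  have hdetM : IsUnit M.det := Matrix.isUnits_det_units γ
  have e00 : V 0 0 * M 0 0 + V 0 1 * M 1 0 = M 0 0 := by
    have := congrFun (congrFun hUγ 0) 0
    simp [Matrix.mul_apply, Fin.sum_univ_two] at this
    exact this.trans h00.symm
  have e01 : V 0 0 * M 0 1 + V 0 1 * M 1 1 = M 0 1 := by
    have := congrFun (congrFun hUγ 0) 1
    simp [Matrix.mul_apply, Fin.sum_univ_two] at this
    exact this.trans h01.symm
  rw [Matrix.det_fin_two] at hdetM
  -- first row of `V` is `(1, 0)`
  have hV00 : V 0 0 = 1 := by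
    have h : (V 0 0 - 1) * (M 0 0 * M 1 1 - M 0 1 * M 1 0) = 0 := by
      linear_combination M 1 1 * e00 - M 1 0 * e01
    have := (mul_eq_zero.mp h).resolve_right hdetM.ne_zero
    linarith
  have hV01 : V 0 1 = 0 := by
    rw [hV00, one_mul] at e00 e01
    have h1 : V 0 1 * M 1 0 = 0 := by linarith
    have h2 : V 0 1 * M 1 1 = 0 := by linarith
    have h : V 0 1 * (M 0 0 * M 1 1 - M 0 1 * M 1 0) = 0 := by linear_combination M 0 0 * h2 - M 0 1 * h1
    exact (mul_eq_zero.mp h).resolve_right hdetM.ne_zero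
  -- `det V = 1`, so `V 1 1 = 1`
  have hdetV : V.det = 1 := by
    have h := congrArg Matrix.det hUγ
    rw [Matrix.det_mul, ← hdet] at h
    -- `det V * det M = det M`
    have hM0 : M.det ≠ 0 := (Matrix.isUnits_det_units γ).ne_zero
    have : (V.det - 1) * M.det = 0 := by linear_combination h
    have := (mul_eq_zero.mp this).resolve_right hM0
    linarith
  have hV11 : V 1 1 = 1 := by
    rw [Matrix.det_fin_two, hV00, hV01] at hdetV
    linarith
  have hV10 : V 1 0 = 0 := shear_eq_zero_of_mem_stabilizer hb hUmem hV00 hV01 hV11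
  -- so `U = 1` and `γ' = γ`
  have hU1 : U = 1 := by
    apply Units.ext
    ext i j
    fin_cases i <;> fin_cases j <;> simp [← hV, hV00, hV01, hV10, hV11]
  have : γ' = U * γ := by rw [hUdef, inv_mul_cancel_right]
  rw [this, hU1, one_mul]

/-! ### The possible first rows form a finite set -/

/-- The admissible first rows for `Stab(0, b, c, d)`: primitive `(p, q)` with `q (bp² + cpq + dq²) = 0`. [folklore] -/
def firstRows (b c d : ℤ) : Set (ℤ × ℤ) :=
  {v | v.2 * (b * v.1 ^ 2 + c * v.1 * v.2 + d * v.2 ^ 2) = 0 ∧ IsCoprime v.1 v.2}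

/-- A primitive vector with positive second coordinate is recovered from its slope. [folklore] -/
theorem eq_num_den_of_isCoprime {p q : ℤ} (hq : 0 < q) (h : IsCoprime p q) :
    ((p : ℚ) / q).num = p ∧ (((p : ℚ) / q).den : ℤ) = q := by
  have hcop : Nat.Coprime p.natAbs q.natAbs := Int.isCoprime_iff_gcd_eq_one.mp h
  exact ⟨Rat.num_div_eq_of_coprime hq hcop, by exact_mod_cast Rat.den_div_eq_of_coprime hq hcop⟩

/-- **Finitely many admissible first rows** when `b ≠ 0`: `(±1, 0)`, and the primitive vectors on
the (at most two) rational root lines of `bt² + ct + d`. [folklore] -/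
theorem firstRows_finite {b : ℤ} (hb : b ≠ 0) (c d : ℤ) : (firstRows b c d).Finite := by
  classical
  -- the rational quadratic and its finitely many roots
  set P : ℚ[X] := C (b : ℚ) * X ^ 2 + C (c : ℚ) * X + C (d : ℚ) with hP
  have hP0 : P ≠ 0 := by
    intro h
    have := congrArg (fun R : ℚ[X] => R.coeff 2) h
    simp only [hP, coeff_add, coeff_C_mul, coeff_X_pow, coeff_X, coeff_C, coeff_zero] at this
    norm_num at this
    exact hb (by exact_mod_cast this)
  -- split off `q = 0` (then `p = ±1`)
  let B : Set (ℤ × ℤ) := {v | v ∈ firstRows b c d ∧ v.2 ≠ 0}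
  have hsub : firstRows b c d ⊆ {(1, 0), (-1, 0)} ∪ B := by
    intro v hv
    by_cases hq : v.2 = 0
    · left
      have hu : IsUnit v.1 := by
        have hcop := hv.2
        rw [hq] at hcop
        exact isCoprime_zero_right.mp hcop
      rcases Int.isUnit_iff.mp hu with h1 | h1
      · left; exact Prod.ext h1 hq
      · right; exact Prod.ext h1 hq
    · right; exact ⟨hv, hq⟩
  refine Set.Finite.subset (Set.Finite.union (by simp) ?_) hsub
  -- `B` injects into the finite set `roots(P) × Bool` by `v ↦ (p/q, [0 < q])`
  let Φ : ℤ × ℤ → ℚ × Bool := fun v => ((v.1 : ℚ) / v.2, decide (0 < v.2))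
  apply Set.Finite.of_finite_image (f := Φ)
  · refine Set.Finite.subset ((P.roots.toFinset.finite_toSet).prod (Set.finite_univ (α := Bool))) ?_
    rintro _ ⟨v, ⟨⟨hz, -⟩, hq⟩, rfl⟩
    refine ⟨?_, Set.mem_univ _⟩
    simp only [Finset.mem_coe, Multiset.mem_toFinset]
    rw [mem_roots hP0, IsRoot.def]
    have hQ : b * v.1 ^ 2 + c * v.1 * v.2 + d * v.2 ^ 2 = 0 := (mul_eq_zero.mp hz).resolve_left hq
    have hq' : (v.2 : ℚ) ≠ 0 := by exact_mod_cast hq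
    have hQ' : (b : ℚ) * v.1 ^ 2 + c * v.1 * v.2 + d * v.2 ^ 2 = 0 := by exact_mod_cast hQ
    simp only [hP, eval_add, eval_mul, eval_C, eval_pow, eval_X]
    have : (b : ℚ) * ((v.1 : ℚ) / v.2) ^ 2 + c * ((v.1 : ℚ) / v.2) + d =
        ((b : ℚ) * v.1 ^ 2 + c * v.1 * v.2 + d * v.2 ^ 2) / (v.2 : ℚ) ^ 2 := by
      field_simp
    rw [this, hQ', zero_div]
  · rintro v ⟨⟨-, hvcop⟩, hvq⟩ w ⟨⟨-, hwcop⟩, hwq⟩ hvw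
    simp only [Φ, Prod.mk.injEq, decide_eq_decide] at hvw
    obtain ⟨hslope, hsign⟩ := hvw
    rcases lt_or_gt_of_ne hvq with hvneg | hvpos
    · have hwneg : w.2 < 0 := by
        have h1 : ¬ (0 < w.2) := fun h => absurd (hsign.mpr h) (by omega)
        omega
      obtain ⟨hn, hd⟩ := eq_num_den_of_isCoprime (neg_pos.mpr hvneg) hvcop.neg_neg
      obtain ⟨hn', hd'⟩ := eq_num_den_of_isCoprime (neg_pos.mpr hwneg) hwcop.neg_neg
      have hs : (((-v.1 : ℤ) : ℚ) / ((-v.2 : ℤ) : ℚ)) = (((-w.1 : ℤ) : ℚ) / ((-w.2 : ℤ) : ℚ)) := by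
        push_cast
        rw [neg_div_neg_eq, neg_div_neg_eq]
        exact hslope
      rw [hs] at hn hd
      apply Prod.ext
      · linarith [hn.symm.trans hn']
      · linarith [hd.symm.trans hd']
    · have hwpos : 0 < w.2 := hsign.mp hvpos
      obtain ⟨hn, hd⟩ := eq_num_den_of_isCoprime hvpos hvcop
      obtain ⟨hn', hd'⟩ := eq_num_den_of_isCoprime hwpos hwcop
      rw [hslope] at hn hd
      exact Prod.ext (hn.symm.trans hn') (hd.symm.trans hd')

/-! ### Finiteness of the stabilizer -/

/-- **`Stab(0, b, c, d)` is finite for `b ≠ 0`**: it injects into `firstRows × {±1}`. [folklore] -/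
theorem finite_stabilizer_of_a_eq_zero {b : ℤ} (hb : b ≠ 0) (c d : ℤ) :
    Finite (MulAction.stabilizer (GL (Fin 2) ℤ) (⟨0, b, c, d⟩ : BinaryCubic ℤ)) := by
  haveI : Finite (firstRows b c d) := (firstRows_finite hb c d).to_subtype
  refine Finite.of_injective
    (fun γ : MulAction.stabilizer (GL (Fin 2) ℤ) (⟨0, b, c, d⟩ : BinaryCubic ℤ) =>
      ((⟨(((γ : GL (Fin 2) ℤ) : Matrix (Fin 2) (Fin 2) ℤ) 0 0, ((γ : GL (Fin 2) ℤ) : Matrix (Fin 2) (Fin 2) ℤ) 0 1),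
          (row_constraint_of_mem_stabilizer γ.2)⟩ : firstRows b c d),
        decide ((((γ : GL (Fin 2) ℤ) : Matrix (Fin 2) (Fin 2) ℤ)).det = 1))) ?_
  rintro ⟨γ, hγ⟩ ⟨γ', hγ'⟩ h
  simp only [Prod.mk.injEq, Subtype.mk.injEq, decide_eq_decide] at h
  obtain ⟨⟨h00, h01⟩, hdet⟩ := h
  have hd : ((γ : Matrix (Fin 2) (Fin 2) ℤ)).det = ((γ' : Matrix (Fin 2) (Fin 2) ℤ)).det := by
    rcases Int.isUnit_iff.mp (Matrix.isUnits_det_units γ) with h1 | h1 <;>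
      rcases Int.isUnit_iff.mp (Matrix.isUnits_det_units γ') with h2 | h2
    · rw [h1, h2]
    · exact absurd (hdet.mp h1) (by rw [h2]; norm_num)
    · exact absurd (hdet.mpr h2) (by rw [h1]; norm_num)
    · rw [h1, h2]
  exact Subtype.ext (eq_of_mem_stabilizer_of_row_eq hb hγ hγ' h00 h01 hd)

/-- **`Stab(f)` is finite for reducible nondegenerate `f`**: `f` is `GL₂(ℤ)`-equivalent to some
`(0, b, c, d)` with `b ≠ 0` (`Disc = b²(c² − 4bd) ≠ 0`), and stabilizers along an orbit are
conjugate. [folklore] -/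
theorem finite_stabilizer_of_not_isIrreducible {f : BinaryCubic ℤ} (hf : ¬ f.IsIrreducible) (h0 : f.disc ≠ 0) :
    Finite (MulAction.stabilizer (GL (Fin 2) ℤ) f) := by
  obtain ⟨g, hfg, hga⟩ := exists_gl2zEquiv_a_eq_zero hf
  have hdisc : g.disc = f.disc := hfg.disc_eq
  obtain ⟨γ, hγu, rfl⟩ := hfg
  -- the `GL₂(ℤ)` element
  set u : GL (Fin 2) ℤ := ((Matrix.isUnit_iff_isUnit_det γ).mpr hγu).unit with hu
  have hcoe : (u : Matrix (Fin 2) (Fin 2) ℤ) = γ := IsUnit.unit_spec _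
  have hsmul : twist γ f = u • f := by rw [gl_smul_def, hcoe]
  -- the twisted form is `(0, b, c, d)` with `b ≠ 0`
  rcases hg : twist γ f with ⟨a', b', c', d'⟩
  rw [hg] at hga hdisc hsmul
  simp only at hga
  subst hga
  have hb' : b' ≠ 0 := by
    intro hb0
    rw [hb0, disc_of_a_eq_zero] at hdisc
    exact h0 (by rw [← hdisc]; ring)
  haveI := finite_stabilizer_of_a_eq_zero hb' c' d'
  exact Finite.of_equiv _ (MulAction.stabilizerEquivStabilizer hsmul).symm.toEquiv

/-- **The stabilizer of every nondegenerate integral binary cubic form is finite** (irreducible: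
`StabilizerFinite`; reducible: above), so every Shintani weight `1/|Stab(x)|` (BTT (11)) is a
positive rational. [cite: BhargavaTaniguchiThorne2023, §2.4 (11) (the weights |Stab(x)|⁻¹ over nondegenerate orbits)] -/
theorem finite_stabilizer_of_disc_ne_zero {f : BinaryCubic ℤ} (h0 : f.disc ≠ 0) :
    Finite (MulAction.stabilizer (GL (Fin 2) ℤ) f) := by
  by_cases hf : f.IsIrreducible
  · haveI : Fact f.IsIrreducible := ⟨hf⟩
    infer_instance
  · exact finite_stabilizer_of_not_isIrreducible hf h0

/-- `1 ≤ |Stab(f)|` for `Disc f ≠ 0`. [folklore] -/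
theorem one_le_card_stabilizer_of_disc_ne_zero {f : BinaryCubic ℤ} (h0 : f.disc ≠ 0) :
    1 ≤ Nat.card (MulAction.stabilizer (GL (Fin 2) ℤ) f) := by
  haveI := finite_stabilizer_of_disc_ne_zero h0
  exact Nat.one_le_iff_ne_zero.mpr (Nat.card_pos (α := MulAction.stabilizer (GL (Fin 2) ℤ) f)).ne'

/-- Equivalently `|Aut R(f)|` is finite and `≥ 1` for every nondegenerate cubic ring `R(f)`. [folklore] -/
theorem finite_ringAut_of_disc_ne_zero {f : BinaryCubic ℤ} (h0 : f.disc ≠ 0) : Finite (RingAut (RingOfForm f)) := by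
  haveI := finite_stabilizer_of_disc_ne_zero h0
  exact Finite.of_equiv _ (stabEquivAut f).toEquiv

end Literature.NumberTheory.CubicFields
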